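import Literature.Analysis.FluidPDE.TsaiGrowthLemmas
import Literature.Analysis.FluidPDE.LerayProfileRegularity
import Literature.Analysis.FluidPDE.LerayProfileRepresentation
import Literature.Analysis.FluidPDE.RieszKernelBounds
import HarnessLib

/-!
# Discharge of `tsai1998_profile_smooth` (Tsai 1998, p. 33)

Analysis/FluidPDE proof file: the named fact `Literature.Analysis.FluidPDE.tsai1998_profile_smooth`
of `TsaiGrowthLemmas` — for `ν > 0`, `a > 0` and a Leray profile `(U, P)` on `ℝ³`
(`IsLerayProfile ν a U P`: `U ∈ C²`, `P ∈ C¹`, `-νΔU + aU + a(y·∇)U + (U·∇)U + ∇P = 0`,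
`div U = 0` pointwise), `U ∈ C^∞(ℝ³)` (T.-P. Tsai, ARMA 143 (1998), p. 33: "By standard
regularity theory of stationary Navier–Stokes equations, every weak solution `U` of (1.3) is
actually smooth (see, for example, [Ga II, GiM, La, Te])") — is PROVED here
(`tsai1998_profile_smooth_holds`), as the case `ι = Fin 3` of
`IsLerayProfile.contDiff_velocity_infty` (`LerayProfileRegularity`: the `H^s`-bootstrap through
the weak pressure–Poisson equation, the Sobolev algebra `H^s_loc · H^s_loc ⊂ H^s_loc` for
`s > 3/2`, local elliptic regularity for `Δ` and the Sobolev lemma, all proved in the chain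
`FunctionSpaces/L2TemperedDistribution → … → SobolevLocal`). The hypothesis `a > 0` of the fact
is not needed (any `a ∈ ℝ` works) and `ν > 0` is used only as `ν ≠ 0`.

## References

* T.-P. Tsai, *On Leray's self-similar solutions of the Navier–Stokes equations satisfying
  local energy estimates*, Arch. Rational Mech. Anal. 143 (1998) 29–51, p. 33. [Tsai1998]

# Part II. Proof of Tsai's Lemma 3.3 (`U ∈ L^q`, `3 < q < ∞` ⟹ `U = o(|y|)`): discharge of `tsai1998_lemma33`

Analysis/FluidPDE proofs file for the named fact `Literature.Analysis.FluidPDE.tsai1998_lemma33`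
of `TsaiGrowthLemmas` (T.-P. Tsai, *On Leray's self-similar solutions of the Navier–Stokes
equations satisfying local energy estimates*, Arch. Rational Mech. Anal. 143 (1998) 29–51,
**Lemma 3.3**, p. 40): for `ν > 0`, `a > 0`, a Leray profile `(U, P)` on `ℝ³`
(`IsLerayProfile ν a U P`) with `U ∈ L^q`, `3 < q < ∞`, satisfies `U(y) = o(|y|)`:
`theorem tsai1998_lemma33_holds : tsai1998_lemma33`.

## The printed proof and this proof

Tsai (§3.3, pp. 40–42) represents `U(y)` on balls `B_ρ(y₀)`, `ρ ∈ [¾, 1]`, by Green's formula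
for the Stokes system, and estimates five terms: `I₁` (the `aU` term) and `I₃` (the drift
`a(z·∇)U`, one derivative moved onto the Green tensor, `|∇G| ≲ |y−z|⁻²` paired with `U ∈ L^q`,
`q' < 3/2`) are `o(|y₀|)` by Hölder; `I₂`, `I₅` (boundary terms) are harmless after averaging in
`ρ`; and the convection term `I₄ = ∫ ∂G · U⊗U` is `o(|y₀|)` by Hölder if `q > 6`, while for
`3 < q ≤ 6` he uses the Leray–Hardy inequality (3.10) and the gradient estimate of Lemma 3.1
(whose proof needs the Calderón–Zygmund bound (2.3) on the pressure `P̃ = RᵢRⱼ(UᵢUⱼ)`).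

Here the representation step is `IsLerayProfile.ofReal_norm_le_lintegral_ker`
(`LerayProfileRepresentation`, with a divergence-free regularised-Stokeslet test field in place
of the Green tensor of the ball, so that the pressure never appears): for every `y`,

  `|U(y)| ≤ C [ (1+|y|) ∫_{B̄(y,1)} |U| |z−y|⁻² + ∫_{B̄(y,1)} |U|² |z−y|⁻² ]`.      (R)

The linear part is `≤ C(1+|y|) 𝒜 Λ₁` with `𝒜` the `L^q` mass of `U` near `y` (Hölder, `2q' < 3`;
this is Tsai's treatment of `I₁, I₃`). For the quadratic part (Tsai's `I₄`) we replace the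
Hardy/Lemma 3.1 step by an elementary **bootstrap at the point `y₀`**, needing neither Sobolev
nor Calderón–Zygmund: with `J(β, r) = ∫_{B̄(y₀,r)} |U|² |y−y₀|^{-β}` and `δ = 1 − 3/q > 0`,
inserting (R) once into `J` and using Tonelli, Hölder in the inner variable and the Riesz
composition bound `∫ |y−y₀|^{-a}|y−z|^{-b} dy ≲ |z−y₀|^{3−a−b}` (`RieszKernelBounds`) gives

  `J(β, r) ≤ R₀^{δ/2} C [ (1+|y₀|+R₀) Λ 𝒜² + 𝒜 K J(β − δ/2, r+1) ]`     (`recursion_step`),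

and at levels `β ≤ δ/2` the kernel integral is bounded outright (`terminal_step`). After
`n = ⌈4/δ − 1⌉` steps (`chain`), `J(2, 1) ≤ D (1+|y₀|+R₀) 𝒜²` whenever `𝒜 = 𝒜_{y₀}(R₀) ≤ 1`,
`R₀ = n + 3`, whence `|U(y₀)| ≤ D' (1 + |y₀| + R₀) 𝒜_{y₀}(R₀)` (`main_bound`). Since
`𝒜_{y₀}(R₀) → 0` as `|y₀| → ∞` (`tail_small`: `∫|U|^q < ∞`), `U(y₀) = o(|y₀|)`. For `q > 6` no
iteration would be needed (`n` small), exactly as in print ("If `q > 6`, `I₄` is `o(1)` by the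
Hölder inequality", p. 41).

## Contents

* `TsaiLemma33.rep_bound` (kernel form of (R)), `lintegral_lin_le`, `lpBall`, `Jfun`;
* `core_step`, `recursion_step`, `terminal_step`, `setLIntegral_sq_le`, `chain`, `main_bound`;
* `tail_small`; `tsai1998_lemma33_holds`.

## References

* T.-P. Tsai, *On Leray's self-similar solutions of the Navier–Stokes equations satisfying local
  energy estimates*, Arch. Rational Mech. Anal. 143 (1998) 29–51: Lemma 3.3 and its proof,
  §3.3 pp. 40–42, Remark 3.2 [Tsai1998].
* E. M. Stein, *Singular integrals and differentiability properties of functions* (1970), V §1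
  (Riesz potentials). [folklore]
-/

noncomputable section

open MeasureTheory Set Filter Topology Function Real Metric
open scoped ENNReal BigOperators NNReal

namespace Literature.Analysis.FluidPDE

/-- **Discharge of `tsai1998_profile_smooth`** (Tsai 1998, p. 33: weak solutions of Leray's
profile system (1.3) are smooth), for the tree's pointwise profile class on `ℝ³`: the velocity
of a Leray profile with `ν > 0` is `C^∞`. [cite: Tsai1998, p. 33] -/
theorem tsai1998_profile_smooth_holds : tsai1998_profile_smooth := by
  intro ν a hν _ha U P hprof
  exact hprof.contDiff_velocity_infty hν.ne' (by simp)


namespace TsaiLemma33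

open Stokeslet RieszKernel

/-- Local notation for physical space `ℝ³ = EuclideanSpace ℝ (Fin 3)`. -/
local notation "𝔼" => EuclideanSpace ℝ (Fin 3)

/-! ### From the truncated kernel `ker` of the representation to `powKer 2` on the unit ball -/

/-- `ofReal (ker x) = 1_{|x| ≤ 1} |x|^{-2}`. [folklore] -/
theorem ofReal_ker (x : 𝔼) : ENNReal.ofReal (Stokeslet.ker x) = (closedBall (0 : 𝔼) 1).indicator (powKer 2) x := by
  unfold Stokeslet.ker
  by_cases hx : ‖x‖ ≤ 1
  · have hmem : x ∈ closedBall (0 : 𝔼) 1 := by simpa using hx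
    simp only [hx, if_true, indicator_of_mem hmem, powKer]
    rw [Real.rpow_neg (norm_nonneg _), Real.rpow_two]
  · have hmem : x ∉ closedBall (0 : 𝔼) 1 := by simpa using hx
    simp only [hx, if_false, indicator_of_notMem hmem, ENNReal.ofReal_zero]

/-- The linear kernel integral of the representation, as a set integral against `powKer 2`. [folklore] -/
theorem lintegral_norm_mul_ker (U : 𝔼 → 𝔼) (y : 𝔼) :
    ∫⁻ z, ENNReal.ofReal (‖U z‖ * Stokeslet.ker (z - y)) =
      ∫⁻ z in closedBall y 1, ‖U z‖ₑ * powKer 2 (z - y) := by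
  rw [← lintegral_indicator measurableSet_closedBall]
  refine lintegral_congr fun z => ?_
  rw [ENNReal.ofReal_mul (norm_nonneg _), ofReal_norm, ofReal_ker]
  by_cases hz : z ∈ closedBall y 1
  · have hz' : z - y ∈ closedBall (0 : 𝔼) 1 := by simpa [mem_closedBall, dist_eq_norm] using hz
    rw [indicator_of_mem hz, indicator_of_mem hz']
  · have hz' : z - y ∉ closedBall (0 : 𝔼) 1 := by simpa [mem_closedBall, dist_eq_norm] using hz
    rw [indicator_of_notMem hz, indicator_of_notMem hz', mul_zero]

/-- The quadratic kernel integral of the representation, as a set integral against `powKer 2`. [folklore] -/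
theorem lintegral_norm_sq_mul_ker (U : 𝔼 → 𝔼) (y : 𝔼) :
    ∫⁻ z, ENNReal.ofReal (‖U z‖ ^ 2 * Stokeslet.ker (z - y)) =
      ∫⁻ z in closedBall y 1, ‖U z‖ₑ ^ 2 * powKer 2 (z - y) := by
  rw [← lintegral_indicator measurableSet_closedBall]
  refine lintegral_congr fun z => ?_
  rw [ENNReal.ofReal_mul (by positivity), ENNReal.ofReal_pow (norm_nonneg _), ofReal_norm, ofReal_ker]
  by_cases hz : z ∈ closedBall y 1
  · have hz' : z - y ∈ closedBall (0 : 𝔼) 1 := by simpa [mem_closedBall, dist_eq_norm] using hz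
    rw [indicator_of_mem hz, indicator_of_mem hz']
  · have hz' : z - y ∉ closedBall (0 : 𝔼) 1 := by simpa [mem_closedBall, dist_eq_norm] using hz
    rw [indicator_of_notMem hz, indicator_of_notMem hz', mul_zero]

variable {ν a : ℝ} {U : 𝔼 → 𝔼} {P : 𝔼 → ℝ}

/-- **The representation bound in kernel form**: `‖U(y)‖ₑ ≤ C[(1+|y|) ∫_{B̄(y,1)} ‖U‖ |z−y|⁻² +
∫_{B̄(y,1)} ‖U‖² |z−y|⁻²]` (`IsLerayProfile.ofReal_norm_le_lintegral_ker`). [folklore] -/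
theorem rep_bound (h : IsLerayProfile ν a U P) (hν : 0 < ν) (ha : 0 ≤ a) :
    ∃ C : ℝ, 0 < C ∧ ∀ y : 𝔼, ‖U y‖ₑ ≤ ENNReal.ofReal C *
      (ENNReal.ofReal (1 + ‖y‖) * (∫⁻ z in closedBall y 1, ‖U z‖ₑ * powKer 2 (z - y)) +
        ∫⁻ z in closedBall y 1, ‖U z‖ₑ ^ 2 * powKer 2 (z - y)) := by
  obtain ⟨C, hC, hb⟩ := h.ofReal_norm_le_lintegral_ker hν ha
  refine ⟨C, hC, fun y => ?_⟩
  have := hb y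
  rwa [ofReal_norm, lintegral_norm_mul_ker, lintegral_norm_sq_mul_ker] at this

/-! ### Hölder on sets and the kernel constants -/

/-- Measurability of `‖U‖ₑ` for continuous `U`. [folklore] -/
theorem measurable_enorm_of_continuous {U : 𝔼 → 𝔼} (hU : Continuous U) : Measurable fun z => ‖U z‖ₑ :=
  hU.measurable.enorm

/-- **Hölder on a set**: `∫_S f w ≤ (∫_S f^p)^{1/p} (∫_S w^{p'})^{1/p'}`. [folklore] -/
theorem setLIntegral_mul_le {p p' : ℝ} (hpp : p.HolderConjugate p') {f w : 𝔼 → ℝ≥0∞}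
    (hf : Measurable f) (hw : Measurable w) (S : Set 𝔼) :
    ∫⁻ z in S, f z * w z ≤ (∫⁻ z in S, f z ^ p) ^ (1 / p) * (∫⁻ z in S, w z ^ p') ^ (1 / p') :=
  ENNReal.lintegral_mul_le_Lp_mul_Lq _ hpp hf.aemeasurable hw.aemeasurable

/-- The `L^p` mass of `U` on a closed ball, `(∫_{B̄(c,R)} ‖U‖^p)^{1/p}`. [folklore] -/
def lpBall (U : 𝔼 → 𝔼) (p : ℝ) (c : 𝔼) (R : ℝ) : ℝ≥0∞ := (∫⁻ z in closedBall c R, ‖U z‖ₑ ^ p) ^ (1 / p)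

/-- Monotonicity of the `L^p` mass in the ball. [folklore] -/
theorem lpBall_mono {U : 𝔼 → 𝔼} {p : ℝ} (hp : 0 < p) {c c' : 𝔼} {R R' : ℝ}
    (h : closedBall c R ⊆ closedBall c' R') : lpBall U p c R ≤ lpBall U p c' R' := by
  unfold lpBall
  gcongr

/-- **The linear kernel integral is small**: for `y ∈ B̄(y₀, R₀ − 1)`,
`∫_{B̄(y,1)} ‖U‖ |z−y|⁻² ≤ 𝒜(R₀) Λ₁`, `Λ₁ = (∫_{B̄(0,2R₀)} |x|^{-2p'})^{1/p'}` (Hölder; `2p' < 3`). [folklore] -/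
theorem lintegral_lin_le {U : 𝔼 → 𝔼} (hU : Continuous U) {p p' : ℝ} (hpp : p.HolderConjugate p')
    (y₀ : 𝔼) (R₀ : ℝ) {y : 𝔼} (hy : y ∈ closedBall y₀ (R₀ - 1)) :
    ∫⁻ z in closedBall y 1, ‖U z‖ₑ * powKer 2 (z - y) ≤
      lpBall U p y₀ R₀ * (∫⁻ x in closedBall (0 : 𝔼) (2 * R₀), powKer (2 * p') x) ^ (1 / p') := by
  have hp : 0 < p := hpp.pos
  have hsub1 : closedBall y 1 ⊆ closedBall y₀ R₀ := by
    intro z hz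
    rw [mem_closedBall] at hz hy ⊢
    linarith [dist_triangle z y y₀]
  have hsub2 : closedBall y₀ R₀ ⊆ closedBall y (2 * R₀) := by
    intro z hz
    rw [mem_closedBall] at hz hy ⊢
    have := dist_triangle z y₀ y
    rw [dist_comm y₀ y] at this
    have hR : 0 ≤ R₀ - 1 := dist_nonneg.trans hy
    linarith
  calc ∫⁻ z in closedBall y 1, ‖U z‖ₑ * powKer 2 (z - y)
      ≤ ∫⁻ z in closedBall y₀ R₀, ‖U z‖ₑ * powKer 2 (z - y) := lintegral_mono_set hsub1
    _ ≤ (∫⁻ z in closedBall y₀ R₀, ‖U z‖ₑ ^ p) ^ (1 / p) *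
          (∫⁻ z in closedBall y₀ R₀, powKer 2 (z - y) ^ p') ^ (1 / p') :=
        setLIntegral_mul_le hpp (measurable_enorm_of_continuous hU) (measurable_powKer_sub 2 y) _
    _ ≤ lpBall U p y₀ R₀ * (∫⁻ x in closedBall (0 : 𝔼) (2 * R₀), powKer (2 * p') x) ^ (1 / p') := by
        unfold lpBall
        gcongr _ * ?_
        refine ENNReal.rpow_le_rpow ?_ (one_div_nonneg.2 hpp.symm.nonneg)
        simp_rw [powKer_rpow hpp.symm.nonneg]
        calc ∫⁻ z in closedBall y₀ R₀, powKer (2 * p') (z - y)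
            ≤ ∫⁻ z in closedBall y (2 * R₀), powKer (2 * p') (z - y) := lintegral_mono_set hsub2
          _ = _ := setLIntegral_closedBall_comp_sub _ _ _

/-! ### The functional `J` and the bootstrap step -/

/-- `J(β, r) = ∫_{B̄(y₀,r)} ‖U(y)‖² |y − y₀|^{-β} dy`. [folklore] -/
def Jfun (U : 𝔼 → 𝔼) (y₀ : 𝔼) (β r : ℝ) : ℝ≥0∞ := ∫⁻ y in closedBall y₀ r, ‖U y‖ₑ ^ 2 * powKer β (y - y₀)

/-- Raising the exponent on a bounded region: `|x|^{-β} ≤ R^{γ} |x|^{-(β+γ)}` for `0 < |x| ≤ R`,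
`γ ≥ 0`. [folklore] -/
theorem powKer_le_mul_powKer_add {β γ R : ℝ} (hγ : 0 ≤ γ) {x : 𝔼} (hx : x ≠ 0) (hxR : ‖x‖ ≤ R) :
    powKer β x ≤ ENNReal.ofReal (R ^ γ) * powKer (β + γ) x := by
  have hx0 : 0 < ‖x‖ := norm_pos_iff.2 hx
  have hR : 0 ≤ R := (norm_nonneg x).trans hxR
  rw [powKer, powKer, ← ENNReal.ofReal_mul (Real.rpow_nonneg hR _)]
  refine ENNReal.ofReal_le_ofReal ?_
  have e : ‖x‖ ^ (-β) = ‖x‖ ^ γ * ‖x‖ ^ (-(β + γ)) := by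
    rw [← Real.rpow_add hx0]; ring_nf
  rw [e]
  exact mul_le_mul_of_nonneg_right (Real.rpow_le_rpow (norm_nonneg _) hxR hγ)
    (Real.rpow_nonneg (norm_nonneg _) _)

/-- `J` with a raised exponent dominates: `J(β, r) ≤ R₀^γ J(β + γ, r)` for `r ≤ R₀`, `γ ≥ 0`. [folklore] -/
theorem Jfun_le_mul_Jfun_add (U : 𝔼 → 𝔼) (y₀ : 𝔼) {β γ r R₀ : ℝ} (hγ : 0 ≤ γ) (hr : r ≤ R₀) :
    Jfun U y₀ β r ≤ ENNReal.ofReal (R₀ ^ γ) * Jfun U y₀ (β + γ) r := by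
  unfold Jfun
  rw [← lintegral_const_mul' _ _ ENNReal.ofReal_ne_top]
  refine lintegral_mono_ae ?_
  filter_upwards [ae_restrict_mem (measurableSet_closedBall (x := y₀) (ε := r)),
    ae_restrict_of_ae (Stokeslet.ae_ne y₀)] with y hy hne
  have hx : y - y₀ ≠ 0 := sub_ne_zero.2 hne
  have hxR : ‖y - y₀‖ ≤ R₀ := by
    rw [mem_closedBall, dist_eq_norm] at hy
    exact hy.trans hr
  calc ‖U y‖ₑ ^ 2 * powKer β (y - y₀) ≤ ‖U y‖ₑ ^ 2 * (ENNReal.ofReal (R₀ ^ γ) * powKer (β + γ) (y - y₀)) :=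
        mul_le_mul' le_rfl (powKer_le_mul_powKer_add hγ hx hxR)
    _ = _ := by ring

/-- Measurability of the two-variable integrand used in the Tonelli step. [folklore] -/
theorem measurable_uncurry_integrand {U : 𝔼 → 𝔼} (hU : Continuous U) (β' : ℝ) (y₀ : 𝔼) :
    Measurable (uncurry fun (y z : 𝔼) =>
      ‖U y‖ₑ * powKer β' (y - y₀) * (‖U z‖ₑ ^ 2 * powKer 2 (z - y))) := by
  have h1 : Measurable fun q : 𝔼 × 𝔼 => ‖U q.1‖ₑ := (hU.measurable.comp measurable_fst).enorm
  have h2 : Measurable fun q : 𝔼 × 𝔼 => powKer β' (q.1 - y₀) :=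
    (measurable_powKer β').comp (measurable_fst.sub measurable_const)
  have h3 : Measurable fun q : 𝔼 × 𝔼 => ‖U q.2‖ₑ ^ 2 := ((hU.measurable.comp measurable_snd).enorm).pow_const _
  have h4 : Measurable fun q : 𝔼 × 𝔼 => powKer 2 (q.2 - q.1) :=
    (measurable_powKer 2).comp (measurable_snd.sub measurable_fst)
  exact (h1.mul h2).mul (h3.mul h4)

/-- **The core step of the bootstrap.** Insert the representation bound once into
`J(β', r) = ∫_{B̄(y₀,r)} ‖U‖² |y−y₀|^{-β'}`: the linear part is controlled by Hölder through the
`L^p` mass `𝒜 = 𝒜(R₀)` of `U` on `B̄(y₀,R₀)`, and the quadratic part, after Tonelli and Hölder in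
the inner variable, by `𝒜 ∫_{B̄(y₀,r+1)} ‖U(z)‖² (∫_{B̄(y₀,r)} |y−y₀|^{-β'p'} |y−z|^{-2p'} dy)^{1/p'} dz`.
[folklore] -/
theorem core_step {U : 𝔼 → 𝔼} (hU : Continuous U) {C : ℝ}
    (hrep : ∀ y : 𝔼, ‖U y‖ₑ ≤ ENNReal.ofReal C *
      (ENNReal.ofReal (1 + ‖y‖) * (∫⁻ z in closedBall y 1, ‖U z‖ₑ * powKer 2 (z - y)) +
        ∫⁻ z in closedBall y 1, ‖U z‖ₑ ^ 2 * powKer 2 (z - y)))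
    {p p' : ℝ} (hpp : p.HolderConjugate p') (y₀ : 𝔼) {r R₀ : ℝ} (hr : r + 1 ≤ R₀) (β' : ℝ) :
    Jfun U y₀ β' r ≤ ENNReal.ofReal C *
      (ENNReal.ofReal (1 + ‖y₀‖ + R₀) * (lpBall U p y₀ R₀ *
          (∫⁻ x in closedBall (0 : 𝔼) (2 * R₀), powKer (2 * p') x) ^ (1 / p')) *
        (lpBall U p y₀ R₀ * (∫⁻ y in closedBall y₀ r, powKer (β' * p') (y - y₀)) ^ (1 / p')) +
      lpBall U p y₀ R₀ * ∫⁻ z in closedBall y₀ (r + 1), ‖U z‖ₑ ^ 2 *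
        (∫⁻ y in closedBall y₀ r, powKer (β' * p') (y - y₀) * powKer (2 * p') (y - z)) ^ (1 / p')) := by
  have hp : 0 < p := hpp.pos
  have hmU : Measurable fun z => ‖U z‖ₑ := measurable_enorm_of_continuous hU
  set 𝒜 := lpBall U p y₀ R₀ with h𝒜
  set Λ₁ := (∫⁻ x in closedBall (0 : 𝔼) (2 * R₀), powKer (2 * p') x) ^ (1 / p') with hΛ₁
  set L := ENNReal.ofReal (1 + ‖y₀‖ + R₀) with hL
  set w : 𝔼 → ℝ≥0∞ := fun y => powKer β' (y - y₀) with hw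
  have hmw : Measurable w := measurable_powKer_sub β' y₀
  set H : 𝔼 → ℝ≥0∞ := fun y => ∫⁻ z in closedBall y₀ (r + 1), ‖U z‖ₑ ^ 2 * powKer 2 (z - y) with hH
  -- pointwise: on `B̄(y₀,r)` the representation bound with the linear part made constant
  have hpt : ∀ y ∈ closedBall y₀ r, ‖U y‖ₑ ^ 2 * w y ≤
      ENNReal.ofReal C * (‖U y‖ₑ * (L * (𝒜 * Λ₁)) * w y) + ENNReal.ofReal C * (‖U y‖ₑ * w y * H y) := by
    intro y hy
    have hy' : y ∈ closedBall y₀ (R₀ - 1) := by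
      rw [mem_closedBall] at hy ⊢; linarith
    have hI₁ := lintegral_lin_le hU hpp y₀ R₀ hy'
    have hLy : ENNReal.ofReal (1 + ‖y‖) ≤ L := by
      refine ENNReal.ofReal_le_ofReal ?_
      rw [mem_closedBall, dist_eq_norm] at hy
      have := norm_sub_norm_le y y₀
      linarith
    have hI₂ : ∫⁻ z in closedBall y 1, ‖U z‖ₑ ^ 2 * powKer 2 (z - y) ≤ H y := by
      refine lintegral_mono_set fun z hz => ?_
      rw [mem_closedBall] at hz hy ⊢
      linarith [dist_triangle z y y₀]
    have hb : ‖U y‖ₑ ≤ ENNReal.ofReal C * (L * (𝒜 * Λ₁) + H y) := by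
      refine (hrep y).trans ?_
      gcongr
    calc ‖U y‖ₑ ^ 2 * w y = ‖U y‖ₑ * ‖U y‖ₑ * w y := by rw [sq]
      _ ≤ ‖U y‖ₑ * (ENNReal.ofReal C * (L * (𝒜 * Λ₁) + H y)) * w y := by gcongr
      _ = _ := by ring
  -- integrate the pointwise bound
  have hm1 : Measurable fun y => ENNReal.ofReal C * (‖U y‖ₑ * (L * (𝒜 * Λ₁)) * w y) :=
    ((hmU.mul measurable_const).mul hmw).const_mul _
  have hstep1 : Jfun U y₀ β' r ≤
      (∫⁻ y in closedBall y₀ r, ENNReal.ofReal C * (‖U y‖ₑ * (L * (𝒜 * Λ₁)) * w y)) +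
        ∫⁻ y in closedBall y₀ r, ENNReal.ofReal C * (‖U y‖ₑ * w y * H y) := by
    unfold Jfun
    rw [← lintegral_add_left hm1]
    exact setLIntegral_mono' measurableSet_closedBall fun y hy => hpt y hy
  -- the linear part
  have hlin : ∫⁻ y in closedBall y₀ r, ENNReal.ofReal C * (‖U y‖ₑ * (L * (𝒜 * Λ₁)) * w y) ≤
      ENNReal.ofReal C * (L * (𝒜 * Λ₁) *
        (𝒜 * (∫⁻ y in closedBall y₀ r, powKer (β' * p') (y - y₀)) ^ (1 / p'))) := by
    have e : ∀ y, ENNReal.ofReal C * (‖U y‖ₑ * (L * (𝒜 * Λ₁)) * w y) =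
        ENNReal.ofReal C * (L * (𝒜 * Λ₁)) * (‖U y‖ₑ * w y) := fun y => by ring
    simp_rw [e]
    rw [lintegral_const_mul (f := fun y => ‖U y‖ₑ * w y) _ (hmU.mul hmw), mul_assoc]
    gcongr
    calc ∫⁻ y in closedBall y₀ r, ‖U y‖ₑ * w y
        ≤ (∫⁻ y in closedBall y₀ r, ‖U y‖ₑ ^ p) ^ (1 / p) * (∫⁻ y in closedBall y₀ r, w y ^ p') ^ (1 / p') :=
          setLIntegral_mul_le hpp hmU hmw _
      _ ≤ 𝒜 * (∫⁻ y in closedBall y₀ r, powKer (β' * p') (y - y₀)) ^ (1 / p') := by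
          simp_rw [hw, powKer_rpow hpp.symm.nonneg]
          gcongr
          exact lpBall_mono hp (closedBall_subset_closedBall (by linarith))
  -- the quadratic part: Tonelli
  have hquad : ∫⁻ y in closedBall y₀ r, ENNReal.ofReal C * (‖U y‖ₑ * w y * H y) ≤
      ENNReal.ofReal C * (𝒜 * ∫⁻ z in closedBall y₀ (r + 1), ‖U z‖ₑ ^ 2 *
        (∫⁻ y in closedBall y₀ r, powKer (β' * p') (y - y₀) * powKer (2 * p') (y - z)) ^ (1 / p')) := by
    rw [lintegral_const_mul' _ _ ENNReal.ofReal_ne_top]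
    gcongr
    -- move `‖U y‖ w y` inside and swap
    have e1 : ∀ y, ‖U y‖ₑ * w y * H y =
        ∫⁻ z in closedBall y₀ (r + 1), ‖U y‖ₑ * w y * (‖U z‖ₑ ^ 2 * powKer 2 (z - y)) := by
      intro y
      have hne : ‖U y‖ₑ * w y ≠ ⊤ := ENNReal.mul_ne_top enorm_ne_top (by rw [hw]; exact ENNReal.ofReal_ne_top)
      rw [hH]
      exact (lintegral_const_mul' (‖U y‖ₑ * w y) (fun z => ‖U z‖ₑ ^ 2 * powKer 2 (z - y)) hne).symm
    -- inner Hölder, for each `z`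
    have e2 : ∀ z, ∫⁻ y in closedBall y₀ r, ‖U y‖ₑ * w y * (‖U z‖ₑ ^ 2 * powKer 2 (z - y)) =
        ‖U z‖ₑ ^ 2 * ∫⁻ y in closedBall y₀ r, ‖U y‖ₑ * (w y * powKer 2 (z - y)) := by
      intro z
      rw [← lintegral_const_mul (f := fun y => ‖U y‖ₑ * (w y * powKer 2 (z - y))) _
        (hmU.mul (hmw.mul ((measurable_powKer 2).comp (measurable_const.sub measurable_id))))]
      refine lintegral_congr fun y => ?_
      ring
    have hswap : ∫⁻ y in closedBall y₀ r, ‖U y‖ₑ * w y * H y =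
        ∫⁻ z in closedBall y₀ (r + 1), ‖U z‖ₑ ^ 2 * ∫⁻ y in closedBall y₀ r, ‖U y‖ₑ * (w y * powKer 2 (z - y)) := by
      rw [lintegral_congr e1,
        lintegral_lintegral_swap ((measurable_uncurry_integrand hU β' y₀).aemeasurable)]
      exact lintegral_congr e2
    rw [hswap]
    calc ∫⁻ z in closedBall y₀ (r + 1), ‖U z‖ₑ ^ 2 * ∫⁻ y in closedBall y₀ r, ‖U y‖ₑ * (w y * powKer 2 (z - y))
        ≤ ∫⁻ z in closedBall y₀ (r + 1), ‖U z‖ₑ ^ 2 * (𝒜 *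
            (∫⁻ y in closedBall y₀ r, powKer (β' * p') (y - y₀) * powKer (2 * p') (y - z)) ^ (1 / p')) := by
          refine lintegral_mono fun z => ?_
          gcongr
          have f1 : (∫⁻ y in closedBall y₀ r, ‖U y‖ₑ ^ p) ^ (1 / p) ≤ 𝒜 :=
            lpBall_mono hp (closedBall_subset_closedBall (by linarith))
          have f2 : (∫⁻ y in closedBall y₀ r, (w y * powKer 2 (z - y)) ^ p') ^ (1 / p') ≤
              (∫⁻ y in closedBall y₀ r, powKer (β' * p') (y - y₀) * powKer (2 * p') (y - z)) ^ (1 / p') := by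
            refine ENNReal.rpow_le_rpow (le_of_eq (lintegral_congr fun y => ?_)) (one_div_nonneg.2 hpp.symm.nonneg)
            show (powKer β' (y - y₀) * powKer 2 (z - y)) ^ p' = powKer (β' * p') (y - y₀) * powKer (2 * p') (y - z)
            rw [ENNReal.mul_rpow_of_nonneg _ _ hpp.symm.nonneg, powKer_rpow hpp.symm.nonneg,
              powKer_rpow hpp.symm.nonneg, powKer_sub_comm (2 * p') z y]
          calc ∫⁻ y in closedBall y₀ r, ‖U y‖ₑ * (w y * powKer 2 (z - y))
              ≤ (∫⁻ y in closedBall y₀ r, ‖U y‖ₑ ^ p) ^ (1 / p) *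
                  (∫⁻ y in closedBall y₀ r, (w y * powKer 2 (z - y)) ^ p') ^ (1 / p') :=
                setLIntegral_mul_le hpp hmU (hmw.mul ((measurable_powKer 2).comp
                  (measurable_const.sub measurable_id))) _
            _ ≤ 𝒜 * (∫⁻ y in closedBall y₀ r, powKer (β' * p') (y - y₀) * powKer (2 * p') (y - z)) ^ (1 / p') :=
                mul_le_mul' f1 f2
      _ = 𝒜 * ∫⁻ z in closedBall y₀ (r + 1), ‖U z‖ₑ ^ 2 *
            (∫⁻ y in closedBall y₀ r, powKer (β' * p') (y - y₀) * powKer (2 * p') (y - z)) ^ (1 / p') := by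
          have hmI : Measurable fun z : 𝔼 =>
              ∫⁻ y in closedBall y₀ r, powKer (β' * p') (y - y₀) * powKer (2 * p') (y - z) := by
            refine Measurable.lintegral_prod_right'
              (f := fun q : 𝔼 × 𝔼 => powKer (β' * p') (q.2 - y₀) * powKer (2 * p') (q.2 - q.1)) ?_
            exact ((measurable_powKer _).comp (measurable_snd.sub measurable_const)).mul
              ((measurable_powKer _).comp (measurable_snd.sub measurable_fst))
          rw [← lintegral_const_mul (f := fun z => ‖U z‖ₑ ^ 2 *
            (∫⁻ y in closedBall y₀ r, powKer (β' * p') (y - y₀) * powKer (2 * p') (y - z)) ^ (1 / p')) _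
            ((hmU.pow_const 2).mul (hmI.pow_const _))]
          refine lintegral_congr fun z => ?_
          ring
  calc Jfun U y₀ β' r ≤ _ := hstep1
    _ ≤ _ := add_le_add hlin hquad
    _ = _ := (mul_add _ _ _).symm

/-! ### Exponent bookkeeping for `3 < p < ∞` -/

/-- The facts about the conjugate exponent `p'` of `p > 3` used below: `0 < p'`,
`3/p' = 3 − 3/p`, `2p' < 3`. [folklore] -/
theorem conj_facts {p p' : ℝ} (hpp : p.HolderConjugate p') (hp3 : 3 < p) :
    0 < p' ∧ 3 / p' = 3 - 3 / p ∧ 2 * p' < 3 := by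
  have hp : 0 < p := hpp.pos
  have hq : 0 < p' := hpp.symm.pos
  have hinv : p⁻¹ + p'⁻¹ = 1 := hpp.inv_add_inv_eq_one
  have e : 3 / p' = 3 - 3 / p := by
    have : p'⁻¹ = 1 - p⁻¹ := by linarith
    rw [div_eq_mul_inv, this, div_eq_mul_inv]; ring
  refine ⟨hq, e, ?_⟩
  have h3 : 3 / p < 1 := by rw [div_lt_one hp]; exact hp3
  have : 2 < 3 / p' := by rw [e]; linarith
  rwa [lt_div_iff₀ hq] at this

/-! ### The recursive and the terminal step -/

/-- **The recursive step**: for `δ = 1 − 3/p` and a level `β ∈ (δ/2, 2]`,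
`J(β, r) ≤ R₀^{δ/2} C [ (1+|y₀|+R₀) 𝒜² Λ₁ Λ_β + 𝒜 K J(β − δ/2, r+1) ]`: raise the exponent to
`β̃ = β + δ/2`, apply `core_step`, and bound the inner kernel integral by the two-centre Riesz
bound with exponents `a = β̃p'`, `b = 2p'` (`a, b < 3 < a + b`), which produces exactly
`|z − y₀|^{-(β − δ/2)}`. [folklore] -/
theorem recursion_step {U : 𝔼 → 𝔼} (hU : Continuous U) {C : ℝ}
    (hrep : ∀ y : 𝔼, ‖U y‖ₑ ≤ ENNReal.ofReal C *
      (ENNReal.ofReal (1 + ‖y‖) * (∫⁻ z in closedBall y 1, ‖U z‖ₑ * powKer 2 (z - y)) +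
        ∫⁻ z in closedBall y 1, ‖U z‖ₑ ^ 2 * powKer 2 (z - y)))
    {p p' : ℝ} (hpp : p.HolderConjugate p') (hp3 : 3 < p) {β : ℝ} (hβ1 : (1 - 3 / p) / 2 < β) (hβ2 : β ≤ 2) :
    ∃ K : ℝ≥0∞, K < ⊤ ∧ ∀ (y₀ : 𝔼) (r R₀ : ℝ), r + 1 ≤ R₀ →
      Jfun U y₀ β r ≤ ENNReal.ofReal (R₀ ^ ((1 - 3 / p) / 2)) * (ENNReal.ofReal C *
        (ENNReal.ofReal (1 + ‖y₀‖ + R₀) * (lpBall U p y₀ R₀ *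
            (∫⁻ x in closedBall (0 : 𝔼) (2 * R₀), powKer (2 * p') x) ^ (1 / p')) *
          (lpBall U p y₀ R₀ * (∫⁻ x in closedBall (0 : 𝔼) R₀, powKer ((β + (1 - 3 / p) / 2) * p') x) ^ (1 / p')) +
        lpBall U p y₀ R₀ * (K * Jfun U y₀ (β - (1 - 3 / p) / 2) (r + 1)))) := by
  obtain ⟨hq, e3, h2q⟩ := conj_facts hpp hp3
  have hp : 0 < p := hpp.pos
  set δ := 1 - 3 / p with hδ
  have hδ0 : 0 < δ := by
    have : 3 / p < 1 := by rw [div_lt_one hp]; exact hp3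
    linarith
  set βt := β + δ / 2 with hβt
  -- the exponents of the two-centre bound
  have ha0 : 0 ≤ βt * p' := mul_nonneg (by linarith) hq.le
  have ha3 : βt * p' < 3 := by
    have h1 : βt ≤ 2 + δ / 2 := by linarith
    have h2 : (2 + δ / 2) * p' < 3 := by
      have : 2 + δ / 2 < 3 / p' := by
        rw [e3, hδ]
        have : 0 < 3 / p := by positivity
        linarith
      rwa [lt_div_iff₀ hq] at this
    nlinarith
  have hb0 : (0 : ℝ) ≤ 2 * p' := by positivity
  have hab : 3 < βt * p' + 2 * p' := by
    have : 3 / p' < βt + 2 := by rw [e3, hβt, hδ]; linarith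
    rw [div_lt_iff₀ hq] at this
    linarith
  have hexp : (3 - βt * p' - 2 * p') / p' = -(β - δ / 2) := by
    field_simp
    have e3' : 3 = (3 - 3 / p) * p' := by rw [← e3]; field_simp
    rw [hβt]
    nlinarith [e3']
  obtain ⟨K₂, hK₂, hK⟩ := exists_lintegral_powKer_mul_powKer_le ha0 ha3 hb0 h2q hab
  refine ⟨K₂ ^ (1 / p'), ENNReal.rpow_lt_top_of_nonneg (by positivity) hK₂.ne, fun y₀ r R₀ hr => ?_⟩
  have hmU : Measurable fun z => ‖U z‖ₑ := measurable_enorm_of_continuous hU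
  -- raise the exponent
  have hraise := Jfun_le_mul_Jfun_add U y₀ (β := β) (γ := δ / 2) (r := r) (R₀ := R₀) (by linarith) (by linarith)
  refine hraise.trans ?_
  gcongr
  -- the core step at level `β̃`
  refine (core_step hU hrep hpp y₀ hr βt).trans ?_
  gcongr ENNReal.ofReal C * (?_ + lpBall U p y₀ R₀ * ?_)
  · -- the linear part: enlarge `B̄(y₀,r)` to `B̄(y₀,R₀)` and translate
    gcongr _ * (_ * ?_)
    refine ENNReal.rpow_le_rpow ?_ (by positivity)
    calc ∫⁻ y in closedBall y₀ r, powKer (βt * p') (y - y₀)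
        ≤ ∫⁻ y in closedBall y₀ R₀, powKer (βt * p') (y - y₀) :=
          lintegral_mono_set (closedBall_subset_closedBall (by linarith))
      _ = _ := setLIntegral_closedBall_comp_sub _ _ _
  · -- the quadratic part: the two-centre bound, a.e. in `z`
    unfold Jfun
    rw [← lintegral_const_mul' _ _ (ENNReal.rpow_lt_top_of_nonneg (by positivity) hK₂.ne).ne]
    refine lintegral_mono_ae ?_
    filter_upwards [ae_restrict_of_ae (Stokeslet.ae_ne y₀)] with z hz
    rw [mul_left_comm]
    gcongr
    have hz0 : z - y₀ ≠ 0 := sub_ne_zero.2 hz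
    calc (∫⁻ y in closedBall y₀ r, powKer (βt * p') (y - y₀) * powKer (2 * p') (y - z)) ^ (1 / p')
        ≤ (∫⁻ y, powKer (βt * p') (y - y₀) * powKer (2 * p') (y - z)) ^ (1 / p') := by
          gcongr; exact Measure.restrict_le_self
      _ = (∫⁻ u, powKer (βt * p') u * powKer (2 * p') (u - (z - y₀))) ^ (1 / p') := by
          congr 1
          rw [← lintegral_add_right_eq_self (μ := (volume : Measure 𝔼))
            (fun y => powKer (βt * p') (y - y₀) * powKer (2 * p') (y - z)) y₀]
          refine lintegral_congr fun u => ?_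
          congr 2 <;> abel
      _ ≤ (K₂ * ENNReal.ofReal (‖z - y₀‖ ^ (3 - βt * p' - 2 * p'))) ^ (1 / p') := by
          gcongr; exact hK _ hz0
      _ = K₂ ^ (1 / p') * powKer (β - δ / 2) (z - y₀) := by
          rw [ENNReal.mul_rpow_of_nonneg _ _ (by positivity), powKer,
            ENNReal.ofReal_rpow_of_nonneg (by positivity) (by positivity), ← Real.rpow_mul (norm_nonneg _),
            ← div_eq_mul_one_div, hexp]

/-- `∫_{B̄(y₀,R₀)} ‖U‖² ≤ 𝒜(R₀)² |B̄(0,R₀)|^{1 − 2/p}` (Hölder with exponents `p/2`, `p/(p−2)`). [folklore] -/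
theorem setLIntegral_sq_le {U : 𝔼 → 𝔼} (hU : Continuous U) {p : ℝ} (hp2 : 2 < p) (y₀ : 𝔼) (R₀ : ℝ) :
    ∫⁻ z in closedBall y₀ R₀, ‖U z‖ₑ ^ 2 ≤
      lpBall U p y₀ R₀ ^ 2 * (volume (closedBall (0 : 𝔼) R₀)) ^ (1 - 2 / p) := by
  have hp : 0 < p := by linarith
  have hmU : Measurable fun z => ‖U z‖ₑ := measurable_enorm_of_continuous hU
  have ht : (p / 2).HolderConjugate (p / (p - 2)) := by
    refine Real.holderConjugate_iff.2 ⟨by rw [lt_div_iff₀ two_pos]; linarith, ?_⟩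
    have : p - 2 ≠ 0 := by linarith
    field_simp
    ring
  have hp0 : p ≠ 0 := hp.ne'
  have hp2 : p - 2 ≠ 0 := by intro h; linarith
  have h := setLIntegral_mul_le ht (hmU.pow_const 2) measurable_const (closedBall y₀ R₀) (w := fun _ => 1)
  simp only [mul_one, ENNReal.one_rpow, lintegral_const, Measure.restrict_apply MeasurableSet.univ,
    univ_inter] at h
  have e1 : ∀ z : 𝔼, (‖U z‖ₑ ^ 2) ^ (p / 2) = ‖U z‖ₑ ^ p := fun z => by
    rw [← ENNReal.rpow_natCast, ← ENNReal.rpow_mul]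
    congr 1
    push_cast
    field_simp
  have e2 : (∫⁻ z in closedBall y₀ R₀, (‖U z‖ₑ ^ 2) ^ (p / 2)) ^ (1 / (p / 2)) = lpBall U p y₀ R₀ ^ 2 := by
    unfold lpBall
    rw [← ENNReal.rpow_natCast _ 2, ← ENNReal.rpow_mul, lintegral_congr e1]
    congr 1
    push_cast
    field_simp
  have e3 : (volume (closedBall y₀ R₀)) ^ (1 / (p / (p - 2))) =
      (volume (closedBall (0 : 𝔼) R₀)) ^ (1 - 2 / p) := by
    rw [Measure.addHaar_closedBall_center]
    congr 1
    field_simp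
  rw [e2, one_mul, e3] at h
  exact h

/-- **The terminal step**: for a level `0 < β ≤ δ/2`,
`J(β, r) ≤ C [ (1+|y₀|+R₀) 𝒜² Λ₁ Λ_β + 𝒜 K 𝒜² |B̄_{R₀}|^{1−2/p} ]` with `K` the constant of the
bounded case (`a = βp'`, `b = 2p'`, `a + b < 3`). [folklore] -/
theorem terminal_step {U : 𝔼 → 𝔼} (hU : Continuous U) {C : ℝ}
    (hrep : ∀ y : 𝔼, ‖U y‖ₑ ≤ ENNReal.ofReal C *
      (ENNReal.ofReal (1 + ‖y‖) * (∫⁻ z in closedBall y 1, ‖U z‖ₑ * powKer 2 (z - y)) +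
        ∫⁻ z in closedBall y 1, ‖U z‖ₑ ^ 2 * powKer 2 (z - y)))
    {p p' : ℝ} (hpp : p.HolderConjugate p') (hp3 : 3 < p) {β : ℝ} (hβ0 : 0 < β) (hβ1 : β ≤ (1 - 3 / p) / 2)
    (R₀ : ℝ) :
    ∃ K : ℝ≥0∞, K < ⊤ ∧ ∀ (y₀ : 𝔼) (r : ℝ), r + 1 ≤ R₀ →
      Jfun U y₀ β r ≤ ENNReal.ofReal C *
        (ENNReal.ofReal (1 + ‖y₀‖ + R₀) * (lpBall U p y₀ R₀ *
            (∫⁻ x in closedBall (0 : 𝔼) (2 * R₀), powKer (2 * p') x) ^ (1 / p')) *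
          (lpBall U p y₀ R₀ * (∫⁻ x in closedBall (0 : 𝔼) R₀, powKer (β * p') x) ^ (1 / p')) +
        lpBall U p y₀ R₀ * (K * (lpBall U p y₀ R₀ ^ 2 * (volume (closedBall (0 : 𝔼) R₀)) ^ (1 - 2 / p)))) := by
  obtain ⟨hq, e3, h2q⟩ := conj_facts hpp hp3
  have hp : 0 < p := hpp.pos
  have ha : 0 < β * p' := by positivity
  have hb : 0 < 2 * p' := by positivity
  have hab : β * p' + 2 * p' < 3 := by
    have h1 : β + 2 < 3 / p' := by
      rw [e3]
      have : 0 < 3 / p := by positivity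
      have : (1 - 3 / p) / 2 + 2 < 3 - 3 / p := by nlinarith
      linarith
    rw [lt_div_iff₀ hq] at h1
    linarith
  obtain ⟨K₃, hK₃, hK⟩ := exists_setLIntegral_powKer_mul_powKer_le ha hb hab R₀
  refine ⟨K₃ ^ (1 / p'), ENNReal.rpow_lt_top_of_nonneg (by positivity) hK₃.ne, fun y₀ r hr => ?_⟩
  have hmU : Measurable fun z => ‖U z‖ₑ := measurable_enorm_of_continuous hU
  refine (core_step hU hrep hpp y₀ hr β).trans ?_
  gcongr ENNReal.ofReal C * (?_ + lpBall U p y₀ R₀ * ?_)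
  · gcongr _ * (_ * ?_)
    refine ENNReal.rpow_le_rpow ?_ (by positivity)
    calc ∫⁻ y in closedBall y₀ r, powKer (β * p') (y - y₀)
        ≤ ∫⁻ y in closedBall y₀ R₀, powKer (β * p') (y - y₀) :=
          lintegral_mono_set (closedBall_subset_closedBall (by linarith))
      _ = _ := setLIntegral_closedBall_comp_sub _ _ _
  · calc ∫⁻ z in closedBall y₀ (r + 1), ‖U z‖ₑ ^ 2 *
          (∫⁻ y in closedBall y₀ r, powKer (β * p') (y - y₀) * powKer (2 * p') (y - z)) ^ (1 / p')
        ≤ ∫⁻ z in closedBall y₀ (r + 1), ‖U z‖ₑ ^ 2 * K₃ ^ (1 / p') := by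
          refine setLIntegral_mono' measurableSet_closedBall fun z hz => ?_
          gcongr
          have hz' : z ∈ closedBall y₀ R₀ := closedBall_subset_closedBall hr hz
          calc ∫⁻ y in closedBall y₀ r, powKer (β * p') (y - y₀) * powKer (2 * p') (y - z)
              ≤ ∫⁻ y in closedBall y₀ R₀, powKer (β * p') (y - y₀) * powKer (2 * p') (y - z) :=
                lintegral_mono_set (closedBall_subset_closedBall (by linarith))
            _ ≤ K₃ := hK y₀ z hz'
      _ = K₃ ^ (1 / p') * ∫⁻ z in closedBall y₀ (r + 1), ‖U z‖ₑ ^ 2 := by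
          rw [lintegral_mul_const' _ _ (ENNReal.rpow_lt_top_of_nonneg (by positivity) hK₃.ne).ne, mul_comm]
      _ ≤ K₃ ^ (1 / p') * (lpBall U p y₀ R₀ ^ 2 * (volume (closedBall (0 : 𝔼) R₀)) ^ (1 - 2 / p)) := by
          gcongr
          exact (lintegral_mono_set (closedBall_subset_closedBall hr)).trans
            (setLIntegral_sq_le hU (by linarith) y₀ R₀)

/-! ### The finite induction over the levels `β_k = 2 − k δ/2` -/

/-- Elementary `ℝ≥0∞` bookkeeping: `𝒜 X ≤ X` for `𝒜 ≤ 1`. [folklore] -/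
theorem mul_le_of_le_one_ennreal {A X : ℝ≥0∞} (hA : A ≤ 1) : A * X ≤ X := by
  calc A * X ≤ 1 * X := mul_le_mul' hA le_rfl
    _ = X := one_mul X

/-- **The bootstrap.** For `δ = 1 − 3/p`, `n = ⌈4/δ − 1⌉`, `R₀ = n + 3` and every `m ≤ n` there is a
finite `D` with `J(2 − (n−m)δ/2, n−m+1) ≤ D (1+|y₀|+R₀) 𝒜(R₀)²` whenever `𝒜(R₀) ≤ 1`
(terminal step at `m = 0`, recursive step from `m` to `m+1`). [folklore] -/
theorem chain {U : 𝔼 → 𝔼} (hU : Continuous U) {C : ℝ}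
    (hrep : ∀ y : 𝔼, ‖U y‖ₑ ≤ ENNReal.ofReal C *
      (ENNReal.ofReal (1 + ‖y‖) * (∫⁻ z in closedBall y 1, ‖U z‖ₑ * powKer 2 (z - y)) +
        ∫⁻ z in closedBall y 1, ‖U z‖ₑ ^ 2 * powKer 2 (z - y)))
    {p p' : ℝ} (hpp : p.HolderConjugate p') (hp3 : 3 < p) {n : ℕ}
    (hn1 : (4 / (1 - 3 / p) - 1 : ℝ) ≤ n) (hn2 : (n : ℝ) < 4 / (1 - 3 / p)) :
    ∀ m : ℕ, m ≤ n → ∃ D : ℝ≥0∞, D < ⊤ ∧ ∀ y₀ : 𝔼, lpBall U p y₀ ((n : ℝ) + 3) ≤ 1 →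
      Jfun U y₀ (2 - ((n : ℝ) - m) * ((1 - 3 / p) / 2)) ((n : ℝ) - m + 1) ≤
        D * ENNReal.ofReal (1 + ‖y₀‖ + ((n : ℝ) + 3)) * lpBall U p y₀ ((n : ℝ) + 3) ^ 2 := by
  obtain ⟨hq, e3, h2q⟩ := conj_facts hpp hp3
  have hp : 0 < p := hpp.pos
  set δ := 1 - 3 / p with hδ
  have hδ0 : 0 < δ := by
    have : 3 / p < 1 := by rw [div_lt_one hp]; exact hp3
    linarith
  have hδ1 : δ < 1 := by
    have : 0 < 3 / p := by positivity
    rw [hδ]; linarith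
  set R₀ : ℝ := (n : ℝ) + 3 with hR₀
  -- the common finite constants
  set Λ₁ := (∫⁻ x in closedBall (0 : 𝔼) (2 * R₀), powKer (2 * p') x) ^ (1 / p') with hΛ₁
  have hΛ₁f : Λ₁ < ⊤ := by
    refine ENNReal.rpow_lt_top_of_nonneg (by positivity) (lt_top_iff_ne_top.1 ?_)
    simpa using lintegral_closedBall_powKer_sub_lt_top h2q (0 : 𝔼) (2 * R₀)
  have hΛf : ∀ {s : ℝ}, s < 3 → (∫⁻ x in closedBall (0 : 𝔼) R₀, powKer s x) ^ (1 / p') < ⊤ := by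
    intro s hs
    refine ENNReal.rpow_lt_top_of_nonneg (by positivity) (lt_top_iff_ne_top.1 ?_)
    simpa using lintegral_closedBall_powKer_sub_lt_top hs (0 : 𝔼) R₀
  have hL1 : ∀ y₀ : 𝔼, 1 ≤ ENNReal.ofReal (1 + ‖y₀‖ + R₀) := fun y₀ =>
    ENNReal.one_le_ofReal.2 (by
      have h1 := norm_nonneg y₀
      have h2 : (0 : ℝ) ≤ n := Nat.cast_nonneg n
      rw [hR₀]; linarith)
  -- exponent bounds
  have hlev : ∀ m : ℕ, m ≤ n → 2 - ((n : ℝ) - m) * (δ / 2) ≤ 2 := fun m hm => by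
    have : (m : ℝ) ≤ n := by exact_mod_cast hm
    nlinarith
  intro m
  induction m with
  | zero =>
      intro _
      simp only [Nat.cast_zero, sub_zero]
      -- terminal level `β₀ = 2 − n δ/2 ∈ (0, δ/2]`
      have hβ0 : 0 < 2 - (n : ℝ) * (δ / 2) := by
        have : (n : ℝ) * (δ / 2) < 4 / δ * (δ / 2) := by gcongr
        have e : 4 / δ * (δ / 2) = 2 := by field_simp; norm_num
        linarith
      have hβ1 : 2 - (n : ℝ) * (δ / 2) ≤ δ / 2 := by
        have : (4 / δ - 1) * (δ / 2) ≤ (n : ℝ) * (δ / 2) := by gcongr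
        have e : (4 / δ - 1) * (δ / 2) = 2 - δ / 2 := by field_simp; ring
        linarith
      obtain ⟨K, hK, hT⟩ := terminal_step hU hrep hpp hp3 hβ0 hβ1 R₀
      have hexp : (2 - (n : ℝ) * (δ / 2)) * p' < 3 := by
        calc (2 - (n : ℝ) * (δ / 2)) * p' ≤ (δ / 2) * p' := by gcongr
          _ < 3 := by nlinarith
      set Λβ := (∫⁻ x in closedBall (0 : 𝔼) R₀, powKer ((2 - (n : ℝ) * (δ / 2)) * p') x) ^ (1 / p')
        with hΛβ
      set V := (volume (closedBall (0 : 𝔼) R₀)) ^ (1 - 2 / p) with hV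
      have hVf : V < ⊤ := ENNReal.rpow_lt_top_of_nonneg (by
        rw [sub_nonneg, div_le_one hp]; linarith) (measure_closedBall_lt_top).ne
      refine ⟨ENNReal.ofReal C * (Λ₁ * Λβ + K * V), ?_, fun y₀ h𝒜 => ?_⟩
      · exact ENNReal.mul_lt_top ENNReal.ofReal_lt_top (ENNReal.add_lt_top.2
          ⟨ENNReal.mul_lt_top hΛ₁f (hΛf hexp), ENNReal.mul_lt_top hK hVf⟩)
      · have hr : ((n : ℝ) + 1) + 1 ≤ R₀ := by rw [hR₀]; linarith
        refine (hT y₀ _ hr).trans ?_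
        set 𝒜 := lpBall U p y₀ R₀ with h𝒜def
        set L := ENNReal.ofReal (1 + ‖y₀‖ + R₀) with hLdef
        have h1 : L * (𝒜 * Λ₁) * (𝒜 * Λβ) = Λ₁ * Λβ * L * 𝒜 ^ 2 := by ring
        have h2 : 𝒜 * (K * (𝒜 ^ 2 * V)) ≤ K * V * L * 𝒜 ^ 2 := by
          calc 𝒜 * (K * (𝒜 ^ 2 * V)) ≤ K * (𝒜 ^ 2 * V) := mul_le_of_le_one_ennreal h𝒜
            _ = 1 * (K * V * 𝒜 ^ 2) := by ring
            _ ≤ L * (K * V * 𝒜 ^ 2) := mul_le_mul' (hL1 y₀) le_rfl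
            _ = K * V * L * 𝒜 ^ 2 := by ring
        calc ENNReal.ofReal C * (L * (𝒜 * Λ₁) * (𝒜 * Λβ) + 𝒜 * (K * (𝒜 ^ 2 * V)))
            ≤ ENNReal.ofReal C * (Λ₁ * Λβ * L * 𝒜 ^ 2 + K * V * L * 𝒜 ^ 2) := by
              rw [h1]; gcongr
          _ = ENNReal.ofReal C * (Λ₁ * Λβ + K * V) * L * 𝒜 ^ 2 := by ring
  | succ m ih =>
      intro hm
      obtain ⟨D, hD, hJ⟩ := ih (Nat.le_of_succ_le hm)
      have hm' : (m : ℝ) + 1 ≤ n := by exact_mod_cast hm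
      -- the level `β = 2 − (n − m − 1) δ/2 ∈ (δ/2, 2]`
      have hβ1 : δ / 2 < 2 - ((n : ℝ) - (m + 1 : ℕ)) * (δ / 2) := by
        push_cast
        have : ((n : ℝ) - (m + 1)) * (δ / 2) < (4 / δ - 1) * (δ / 2) := by
          have : (n : ℝ) - (m + 1) < 4 / δ - 1 := by
            have : (0 : ℝ) ≤ m := Nat.cast_nonneg m
            linarith
          gcongr
        have e : (4 / δ - 1) * (δ / 2) = 2 - δ / 2 := by field_simp; ring
        linarith
      have hβ2 : 2 - ((n : ℝ) - (m + 1 : ℕ)) * (δ / 2) ≤ 2 := hlev (m + 1) hm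
      obtain ⟨K, hK, hR⟩ := recursion_step hU hrep hpp hp3 hβ1 hβ2
      have hexp : (2 - ((n : ℝ) - (m + 1 : ℕ)) * (δ / 2) + δ / 2) * p' < 3 := by
        have h1 : 2 - ((n : ℝ) - (m + 1 : ℕ)) * (δ / 2) + δ / 2 ≤ 2 + δ / 2 := by linarith
        have h2 : (2 + δ / 2) * p' < 3 := by
          have : 2 + δ / 2 < 3 / p' := by
            rw [e3]
            have : 0 < 3 / p := by positivity
            rw [hδ]; linarith
          rwa [lt_div_iff₀ hq] at this
        calc _ ≤ (2 + δ / 2) * p' := by gcongr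
          _ < 3 := h2
      set Λβ := (∫⁻ x in closedBall (0 : 𝔼) R₀,
        powKer ((2 - ((n : ℝ) - (m + 1 : ℕ)) * (δ / 2) + δ / 2) * p') x) ^ (1 / p') with hΛβ
      refine ⟨ENNReal.ofReal (R₀ ^ (δ / 2)) * (ENNReal.ofReal C * (Λ₁ * Λβ + K * D)), ?_, fun y₀ h𝒜 => ?_⟩
      · exact ENNReal.mul_lt_top ENNReal.ofReal_lt_top (ENNReal.mul_lt_top ENNReal.ofReal_lt_top
          (ENNReal.add_lt_top.2 ⟨ENNReal.mul_lt_top hΛ₁f (hΛf hexp), ENNReal.mul_lt_top hK hD⟩))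
      · have hr : ((n : ℝ) - (m + 1 : ℕ) + 1) + 1 ≤ R₀ := by push_cast; rw [hR₀]; linarith
        refine (hR y₀ _ R₀ hr).trans ?_
        -- the previous level and radius
        have eβ : 2 - ((n : ℝ) - (m + 1 : ℕ)) * (δ / 2) - δ / 2 = 2 - ((n : ℝ) - m) * (δ / 2) := by
          push_cast; ring
        have er : (n : ℝ) - (m + 1 : ℕ) + 1 + 1 = (n : ℝ) - m + 1 := by push_cast; ring
        rw [eβ, er]
        set 𝒜 := lpBall U p y₀ R₀ with h𝒜def
        set L := ENNReal.ofReal (1 + ‖y₀‖ + R₀) with hLdef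
        have hIH := hJ y₀ h𝒜
        have h1 : L * (𝒜 * Λ₁) * (𝒜 * Λβ) = Λ₁ * Λβ * L * 𝒜 ^ 2 := by ring
        have h2 : 𝒜 * (K * (D * L * 𝒜 ^ 2)) ≤ K * D * L * 𝒜 ^ 2 := by
          calc 𝒜 * (K * (D * L * 𝒜 ^ 2)) ≤ K * (D * L * 𝒜 ^ 2) := mul_le_of_le_one_ennreal h𝒜
            _ = K * D * L * 𝒜 ^ 2 := by ring
        calc ENNReal.ofReal (R₀ ^ (δ / 2)) * (ENNReal.ofReal C *
              (L * (𝒜 * Λ₁) * (𝒜 * Λβ) + 𝒜 * (K * Jfun U y₀ (2 - ((n : ℝ) - m) * (δ / 2)) ((n : ℝ) - m + 1))))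
            ≤ ENNReal.ofReal (R₀ ^ (δ / 2)) * (ENNReal.ofReal C *
              (L * (𝒜 * Λ₁) * (𝒜 * Λβ) + 𝒜 * (K * (D * L * 𝒜 ^ 2)))) := by gcongr
          _ ≤ ENNReal.ofReal (R₀ ^ (δ / 2)) * (ENNReal.ofReal C * (Λ₁ * Λβ * L * 𝒜 ^ 2 + K * D * L * 𝒜 ^ 2)) := by
              rw [h1]; gcongr
          _ = ENNReal.ofReal (R₀ ^ (δ / 2)) * (ENNReal.ofReal C * (Λ₁ * Λβ + K * D)) * L * 𝒜 ^ 2 := by ring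

/-- **The main bound.** There are a finite `D` and a radius `R₀ ≥ 1` (depending on `U`, `C` and
`p` only) such that `‖U(y₀)‖ ≤ D (1 + |y₀| + R₀) 𝒜_{y₀}(R₀)` whenever the `L^p` mass
`𝒜_{y₀}(R₀)` of `U` on `B̄(y₀, R₀)` is at most `1`. [folklore] -/
theorem main_bound {U : 𝔼 → 𝔼} (hU : Continuous U) {C : ℝ}
    (hrep : ∀ y : 𝔼, ‖U y‖ₑ ≤ ENNReal.ofReal C *
      (ENNReal.ofReal (1 + ‖y‖) * (∫⁻ z in closedBall y 1, ‖U z‖ₑ * powKer 2 (z - y)) +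
        ∫⁻ z in closedBall y 1, ‖U z‖ₑ ^ 2 * powKer 2 (z - y)))
    {p p' : ℝ} (hpp : p.HolderConjugate p') (hp3 : 3 < p) :
    ∃ (D : ℝ≥0∞) (R₀ : ℝ), D < ⊤ ∧ 1 ≤ R₀ ∧ ∀ y₀ : 𝔼, lpBall U p y₀ R₀ ≤ 1 →
      ‖U y₀‖ₑ ≤ D * ENNReal.ofReal (1 + ‖y₀‖ + R₀) * lpBall U p y₀ R₀ := by
  obtain ⟨hq, e3, h2q⟩ := conj_facts hpp hp3
  have hp : 0 < p := hpp.pos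
  set δ := 1 - 3 / p with hδ
  have hδ0 : 0 < δ := by
    have : 3 / p < 1 := by rw [div_lt_one hp]; exact hp3
    linarith
  have hδ1 : δ < 1 := by
    have : 0 < 3 / p := by positivity
    rw [hδ]; linarith
  -- the number of steps
  set n : ℕ := ⌈4 / δ - 1⌉₊ with hn
  have h4 : 0 ≤ 4 / δ - 1 := by
    rw [sub_nonneg, le_div_iff₀ hδ0]; linarith
  have hn1 : (4 / δ - 1 : ℝ) ≤ n := Nat.le_ceil _
  have hn2 : (n : ℝ) < 4 / δ := by
    have := Nat.ceil_lt_add_one h4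
    rw [← hn] at this
    linarith
  set R₀ : ℝ := (n : ℝ) + 3 with hR₀
  have hR₀1 : 1 ≤ R₀ := by have : (0 : ℝ) ≤ n := Nat.cast_nonneg n; linarith
  obtain ⟨D, hD, hJ⟩ := chain hU hrep hpp hp3 hn1 hn2 n le_rfl
  simp only [sub_self, zero_mul, sub_zero, zero_add] at hJ
  set Λ₁ := (∫⁻ x in closedBall (0 : 𝔼) (2 * R₀), powKer (2 * p') x) ^ (1 / p') with hΛ₁
  have hΛ₁f : Λ₁ < ⊤ := by
    refine ENNReal.rpow_lt_top_of_nonneg (by positivity) (lt_top_iff_ne_top.1 ?_)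
    simpa using lintegral_closedBall_powKer_sub_lt_top h2q (0 : 𝔼) (2 * R₀)
  refine ⟨ENNReal.ofReal C * (Λ₁ + D), R₀, ENNReal.mul_lt_top ENNReal.ofReal_lt_top
    (ENNReal.add_lt_top.2 ⟨hΛ₁f, hD⟩), hR₀1, fun y₀ h𝒜 => ?_⟩
  set 𝒜 := lpBall U p y₀ R₀ with h𝒜def
  set L := ENNReal.ofReal (1 + ‖y₀‖ + R₀) with hLdef
  have hI₁ : ∫⁻ z in closedBall y₀ 1, ‖U z‖ₑ * powKer 2 (z - y₀) ≤ 𝒜 * Λ₁ :=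
    lintegral_lin_le hU hpp y₀ R₀ (mem_closedBall_self (by linarith))
  have hI₂ : ∫⁻ z in closedBall y₀ 1, ‖U z‖ₑ ^ 2 * powKer 2 (z - y₀) ≤ D * L * 𝒜 ^ 2 := hJ y₀ h𝒜
  have hLy : ENNReal.ofReal (1 + ‖y₀‖) ≤ L := ENNReal.ofReal_le_ofReal (by linarith)
  calc ‖U y₀‖ₑ ≤ ENNReal.ofReal C * (L * (𝒜 * Λ₁) + D * L * 𝒜 ^ 2) := by
        refine (hrep y₀).trans ?_
        gcongr
    _ ≤ ENNReal.ofReal C * (L * (𝒜 * Λ₁) + D * L * 𝒜) := by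
        gcongr _ * (_ + _ * ?_)
        rw [sq]
        exact mul_le_of_le_one_ennreal h𝒜
    _ = ENNReal.ofReal C * (Λ₁ + D) * L * 𝒜 := by ring

/-! ### The tail of the `L^p` norm -/

/-- **Tails of `L^p` functions**: if `∫ ‖U‖^p < ∞` then the `L^p` mass of `U` on balls of fixed
radius centred far away is small. [folklore] -/
theorem tail_small {U : 𝔼 → 𝔼} (hU : Continuous U) {p : ℝ} (hfin : ∫⁻ z, ‖U z‖ₑ ^ p < ⊤)
    {η : ℝ≥0∞} (hη : 0 < η) (R₀ : ℝ) :
    ∃ N : ℝ, ∀ y₀ : 𝔼, N ≤ ‖y₀‖ → ∫⁻ z in closedBall y₀ R₀, ‖U z‖ₑ ^ p < η := by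
  have hm : Measurable fun z : 𝔼 => ‖U z‖ₑ ^ p := (measurable_enorm_of_continuous hU).pow_const _
  set μ : Measure 𝔼 := volume.withDensity fun z => ‖U z‖ₑ ^ p with hμ
  set S : ℕ → Set 𝔼 := fun k => {z | (k : ℝ) ≤ ‖z‖} with hS
  have hSm : ∀ k, MeasurableSet (S k) := fun k =>
    measurableSet_le measurable_const measurable_norm
  have hanti : Antitone S := by
    intro k l hkl z hz
    simp only [hS, mem_setOf_eq] at hz ⊢
    exact le_trans (by exact_mod_cast hkl) hz
  have hinter : ⋂ k, S k = ∅ := by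
    ext z
    simp only [mem_iInter, hS, mem_setOf_eq, mem_empty_iff_false, iff_false, not_forall, not_le]
    obtain ⟨k, hk⟩ := exists_nat_gt ‖z‖
    exact ⟨k, hk⟩
  have h0 : μ (S 0) ≠ ⊤ := by
    rw [hμ, withDensity_apply _ (hSm 0)]
    exact (lt_of_le_of_lt (setLIntegral_le_lintegral _ _) hfin).ne
  have hlim : Tendsto (fun k => μ (S k)) atTop (𝓝 0) := by
    have := tendsto_measure_iInter_atTop (μ := μ) (fun k => (hSm k).nullMeasurableSet) hanti ⟨0, h0⟩
    rwa [hinter, measure_empty] at this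
  -- we need a strict inequality: shrink `η` first
  obtain ⟨η', hη', hη'η⟩ := exists_between hη
  obtain ⟨N', hN'⟩ := (ENNReal.tendsto_atTop_zero.1 hlim) η' hη'
  refine ⟨(N' : ℝ) + |R₀|, fun y₀ hy₀ => ?_⟩
  have hsub : closedBall y₀ R₀ ⊆ S N' := by
    intro z hz
    simp only [hS, mem_setOf_eq]
    rw [mem_closedBall, dist_eq_norm] at hz
    have := norm_sub_norm_le y₀ z
    rw [norm_sub_rev] at this
    have hR : R₀ ≤ |R₀| := le_abs_self R₀
    linarith
  calc ∫⁻ z in closedBall y₀ R₀, ‖U z‖ₑ ^ p = μ (closedBall y₀ R₀) := by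
        rw [hμ, withDensity_apply _ measurableSet_closedBall]
    _ ≤ μ (S N') := measure_mono hsub
    _ ≤ η' := hN' N' le_rfl
    _ < η := hη'η

end TsaiLemma33

/-! ### The discharge -/

section Discharge

open TsaiLemma33 Stokeslet RieszKernel

/-- Local notation for physical space `ℝ³ = EuclideanSpace ℝ (Fin 3)`. -/
local notation "ℝ³" => EuclideanSpace ℝ (Fin 3)

/-- **Tsai 1998, Lemma 3.3** (`U ∈ L^q`, `3 < q < ∞` ⟹ `U(y) = o(|y|)`), proved for the
tree's pointwise profile class: the discharge of the named fact `tsai1998_lemma33`.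
Proof: the pressure-free representation bound (`IsLerayProfile.ofReal_norm_le_lintegral_ker`,
Tsai's §3.3 with the regularised Stokeslet in place of the Green tensor of a ball), the
bootstrap `main_bound` (Tsai's estimate of `I₄`, with the Hardy/gradient step replaced by a
finite induction on the singularity of `|y−y₀|^{-β}` using Hölder and the Riesz composition
bound), and the smallness of the `L^q` mass of `U` on balls far away. [cite: Tsai1998, Lemma 3.3 (p. 40)] -/
theorem tsai1998_lemma33_holds : tsai1998_lemma33 := by
  intro ν a hν ha U P hprof q hq hq' hU ε hε
  -- real exponent
  have hqtop : q ≠ ⊤ := hq'.ne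
  have hq0 : q ≠ 0 := (lt_trans (by norm_num) hq).ne'
  set p : ℝ := q.toReal with hp
  have hp3 : 3 < p := by
    have := (ENNReal.toReal_lt_toReal (by norm_num : (3 : ℝ≥0∞) ≠ ⊤) hqtop).2 hq
    simpa using this
  have hp1 : 1 < p := by linarith
  have hp0 : 0 < p := by linarith
  have hpp : p.HolderConjugate (Real.conjExponent p) := Real.HolderConjugate.conjExponent hp1
  -- the representation bound and the main bound
  obtain ⟨C, hC, hrep⟩ := rep_bound hprof hν ha.le
  have hUc : Continuous U := hprof.contDiff_velocity.continuous
  obtain ⟨D, R₀, hD, hR₀, hmain⟩ := main_bound hUc hrep hpp hp3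
  -- finiteness of `∫ ‖U‖^p`
  have hfin : ∫⁻ z, ‖U z‖ₑ ^ p < ⊤ := by
    have := (eLpNorm_lt_top_iff_lintegral_rpow_enorm_lt_top hq0 hqtop).1 hU.eLpNorm_lt_top
    simpa using this
  -- choice of the smallness
  set Dr : ℝ := D.toReal with hDr
  have hDr0 : 0 ≤ Dr := ENNReal.toReal_nonneg
  set η : ℝ := min 1 (ε / (2 * Dr + 1)) with hη
  have hη0 : 0 < η := lt_min one_pos (by positivity)
  have hη1 : η ≤ 1 := min_le_left _ _
  have hηε : 2 * Dr * η ≤ ε := by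
    have h1 : η ≤ ε / (2 * Dr + 1) := min_le_right _ _
    have h2 : 2 * Dr * (ε / (2 * Dr + 1)) ≤ ε := by
      rw [mul_div_assoc']
      rw [div_le_iff₀ (by positivity)]
      nlinarith
    nlinarith
  obtain ⟨N, hN⟩ := tail_small hUc hfin (η := ENNReal.ofReal (η ^ p)) (ENNReal.ofReal_pos.2 (by positivity)) R₀
  refine ⟨max N (1 + R₀), fun y hy => ?_⟩
  have hyN : N ≤ ‖y‖ := (le_max_left _ _).trans hy
  have hyR : 1 + R₀ ≤ ‖y‖ := (le_max_right _ _).trans hy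
  -- the `L^p` mass on `B̄(y, R₀)` is at most `η ≤ 1`
  have h𝒜 : lpBall U p y R₀ ≤ ENNReal.ofReal η := by
    unfold lpBall
    have h1 := (hN y hyN).le
    calc (∫⁻ z in closedBall y R₀, ‖U z‖ₑ ^ p) ^ (1 / p) ≤ (ENNReal.ofReal (η ^ p)) ^ (1 / p) := by gcongr
      _ = ENNReal.ofReal η := by
          rw [ENNReal.ofReal_rpow_of_nonneg (by positivity) (by positivity), ← Real.rpow_mul hη0.le,
            mul_one_div_cancel hp0.ne', Real.rpow_one]
  have h𝒜1 : lpBall U p y R₀ ≤ 1 := h𝒜.trans (by rw [← ENNReal.ofReal_one]; exact ENNReal.ofReal_le_ofReal hη1)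
  have hb := hmain y h𝒜1
  -- convert to real numbers
  have hDfin : D = ENNReal.ofReal Dr := (ENNReal.ofReal_toReal hD.ne).symm
  have hb' : ‖U y‖ₑ ≤ ENNReal.ofReal (Dr * (1 + ‖y‖ + R₀) * η) := by
    refine hb.trans ?_
    rw [hDfin, ENNReal.ofReal_mul (by positivity), ENNReal.ofReal_mul (by positivity)]
    gcongr
  rw [← ofReal_norm, ENNReal.ofReal_le_ofReal_iff (by positivity)] at hb'
  calc ‖U y‖ ≤ Dr * (1 + ‖y‖ + R₀) * η := hb'
    _ ≤ Dr * (2 * ‖y‖) * η := by gcongr; linarith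
    _ = (2 * Dr * η) * ‖y‖ := by ring
    _ ≤ ε * ‖y‖ := by gcongr

end Discharge

end Literature.Analysis.FluidPDE
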